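import Literature.NumberTheory.Transcendental.NesterenkoHilbertBoundOrder
import Literature.RingTheory.MvPolynomial.HomogeneousHilbertFunction
import HarnessLib

/-!
# The naive evaluation at the generic point over `K' = ℚ(U')`: kernel on forms, and the generic
# linear form is a non-zero-divisor modulo `𝔭 K'[x]` (toward `CycleAPIAt3`, crux stmt-Schanuel-6117)

Helper file (siege k8, variation "Chardin Hilbert-function bound") for the registered stub
`CycleAPIAt3 : CycleAPIAt 3` of line `orbit-interpolation-determinant`. Everything is PROVED; no
definitions, no named facts.

Setting: `𝒢 : GSec m` — a homogeneous prime `𝔭 ⊂ ℚ[x₀,…,x_m]` of rank `s + 1` with a chart `x_j ∉ 𝔭`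
(`Literature.NumberTheory.Transcendental.Nesterenko.GSec`), `K' = 𝒢.Kp = Frac ℚ[U']`,
`𝕃 = 𝒢.LL = Frac(ℚ(𝔭)[U'])`, `ξ = 𝒢.xi` the generic point. The NAIVE evaluation is a ring
homomorphism `Ψ : K'[x] → 𝕃` with `Ψ(u) = u` (coefficients `ℚ[U'] → ℚ(𝔭)[U']` by extension of
constants) and `Ψ(x_k) = ξ_k`; it is passed as an argument characterised by these two properties
(`hΨC`, `hΨX`; it exists: `exists_natEval`). Results:

* `natEval_C_mul_eq_zero_iff`, `natEval_map_eq_zero_iff` — `Ψ(ι p) = 0 ↔ p ∈ 𝔭` for `p ∈ ℚ[x]`;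
* `natEval_linForm_ne_zero` — `Ψ(∑ₖ u_{ik} x_k) = ∑ₖ u_{ik} x̄_k ≠ 0`;
* `mem_span_of_natEval_eq_zero` — a `K'`-form of degree `d` killed by `Ψ` is a `K'`-combination
  of forms of degree `d` of `𝔭` (clear denominators, regroup in `U'`, coefficients vanish at the
  generic point `x̄`);
* `mem_span_of_linForm_mul_mem_span` — hence `L_u · f ∈ span_{K'} ι(𝔭_{d+1}) ⇒ f ∈ span_{K'} ι(𝔭_d)`
  for `K'`-forms `f` of degree `d`: the generic linear form is a non-zero-divisor modulo `𝔭 K'[x]`,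
  degreewise.
-/

set_option linter.dupNamespace false
set_option synthInstance.maxHeartbeats 400000

noncomputable section

namespace Summit.Schanuel.Schanuel.Cruxes.ApproximationProperty.OrbitInterpolationDeterminant

namespace CurveHilbertLB

open Literature.NumberTheory.Transcendental Literature.NumberTheory.Transcendental.Nesterenko
open MvPolynomial Module
open Literature.RingTheory.MvPolynomial

variable {m : ℕ} (𝒢 : GSec m)

/-! ## The naive evaluation on rational polynomials -/

/-- Ring homomorphisms out of `ℚ` agree. [folklore] -/
theorem ringHom_rat_eq {R : Type*} [Semiring R] (f g : ℚ →+* R) : f = g :=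
  Subsingleton.elim f g

/-- For a naive evaluation `Ψ` (`Ψ(u) = u`, `Ψ(x_k) = ξ_k`), `Ψ(ι p)` is the image of `p̄ ∈ ℚ(𝔭)` in
`𝕃`, for every `p ∈ ℚ[x]` (only `Ψ(x_k) = ξ_k` is used: ring homomorphisms out of `ℚ` agree).
[folklore] -/
theorem natEval_map_eq (Ψ : MvPolynomial (Fin (m + 1)) 𝒢.Kp →+* 𝒢.LL)
    (hΨX : ∀ k, Ψ (X k) = 𝒢.xi k) (p : Rx m) :
    Ψ (MvPolynomial.map (algebraMap ℚ 𝒢.Kp) p) =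
      algebraMap 𝒢.Lp 𝒢.LL (algebraMap (Rx m) 𝒢.Lp p) := by
  have h : (Ψ.comp (MvPolynomial.map (algebraMap ℚ 𝒢.Kp))) =
      ((algebraMap 𝒢.Lp 𝒢.LL).comp (algebraMap (Rx m) 𝒢.Lp)) := by
    refine MvPolynomial.ringHom_ext (fun q => ?_) (fun k => ?_)
    · -- both sides are ring homomorphisms out of `ℚ`
      have e1 : (Ψ.comp (MvPolynomial.map (algebraMap ℚ 𝒢.Kp))).comp (C : ℚ →+* Rx m) =
          ((algebraMap 𝒢.Lp 𝒢.LL).comp (algebraMap (Rx m) 𝒢.Lp)).comp C := ringHom_rat_eq _ _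
      exact congrArg (fun φ : ℚ →+* 𝒢.LL => φ q) e1
    · rw [RingHom.comp_apply, map_X, hΨX, RingHom.comp_apply, GSec.xi, GSec.xb,
        NesterenkoK.xbar]
  exact congrArg (fun φ : Rx m →+* 𝒢.LL => φ p) h

/-- **`Ψ(ι p) = 0 ↔ p ∈ 𝔭`** (generic point). [folklore] -/
theorem natEval_map_eq_zero_iff (Ψ : MvPolynomial (Fin (m + 1)) 𝒢.Kp →+* 𝒢.LL)
    (hΨX : ∀ k, Ψ (X k) = 𝒢.xi k) (p : Rx m) :
    Ψ (MvPolynomial.map (algebraMap ℚ 𝒢.Kp) p) = 0 ↔ p ∈ 𝒢.𝔭 := by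
  rw [natEval_map_eq 𝒢 Ψ hΨX, map_eq_zero_iff _ (algebraMap 𝒢.Lp 𝒢.LL).injective]
  exact NesterenkoK.algebraMap_eq_zero_iff 𝒢.𝔭 p

/-! ## Existence of the naive evaluation -/

/-- **The naive evaluation exists**: the ring homomorphism `ℚ[U'] → 𝕃` (extension of constants
`ℚ → ℚ(𝔭)`, then `ℚ(𝔭)[U'] ⊂ 𝕃`) is injective, so it extends to `K' = Frac ℚ[U']`, and then to
`K'[x]` by `x_k ↦ ξ_k`. [folklore] -/
theorem exists_natEval : ∃ Ψ : MvPolynomial (Fin (m + 1)) 𝒢.Kp →+* 𝒢.LL,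
    (∀ a : RU 𝒢.s m, Ψ (C (algebraMap (RU 𝒢.s m) 𝒢.Kp a)) =
      algebraMap 𝒢.RUL 𝒢.LL (MvPolynomial.map (algebraMap ℚ 𝒢.Lp) a)) ∧
    ∀ k, Ψ (X k) = 𝒢.xi k := by
  set θ : RU 𝒢.s m →+* 𝒢.LL :=
    (algebraMap 𝒢.RUL 𝒢.LL).comp (MvPolynomial.map (algebraMap ℚ 𝒢.Lp)) with hθ
  have hθinj : Function.Injective θ :=
    (IsFractionRing.injective 𝒢.RUL 𝒢.LL).comp
      (MvPolynomial.map_injective _ (algebraMap ℚ 𝒢.Lp).injective)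
  refine ⟨eval₂Hom (IsFractionRing.lift hθinj) 𝒢.xi, fun a => ?_, fun k => ?_⟩
  · rw [eval₂Hom_C, IsFractionRing.lift_algebraMap]
    rfl
  · exact eval₂Hom_X' _ _ k

/-! ## The generic linear form does not vanish at the generic point -/

/-- `ξ_k` through the constants of `ℚ(𝔭)[U']`. [folklore] -/
theorem xi_eq_algebraMap_C (k : Fin (m + 1)) : 𝒢.xi k = algebraMap 𝒢.RUL 𝒢.LL (C (𝒢.xb k)) := by
  rw [GSec.xi, GSec.algebraMap_Lp_eq]

/-- **`Ψ(L_u) = ∑ₖ u_{ik} x̄_k ≠ 0`**: the generic linear form does not vanish under the NAIVE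
evaluation (the coefficient of `u_{ij}` is `x̄_j ≠ 0`). [folklore] -/
theorem natEval_linForm_ne_zero (Ψ : MvPolynomial (Fin (m + 1)) 𝒢.Kp →+* 𝒢.LL)
    (hΨC : ∀ a : RU 𝒢.s m, Ψ (C (algebraMap (RU 𝒢.s m) 𝒢.Kp a)) =
      algebraMap 𝒢.RUL 𝒢.LL (MvPolynomial.map (algebraMap ℚ 𝒢.Lp) a))
    (hΨX : ∀ k, Ψ (X k) = 𝒢.xi k) (i : Fin 𝒢.s) :
    Ψ (∑ k : Fin (m + 1), C (algebraMap (RU 𝒢.s m) 𝒢.Kp (X (i, k))) * X k) ≠ 0 := by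
  classical
  have h : Ψ (∑ k : Fin (m + 1), C (algebraMap (RU 𝒢.s m) 𝒢.Kp (X (i, k))) * X k) =
      algebraMap 𝒢.RUL 𝒢.LL (∑ k : Fin (m + 1), X (i, k) * C (𝒢.xb k)) := by
    rw [map_sum, map_sum]
    refine Finset.sum_congr rfl fun k _ => ?_
    rw [map_mul, hΨC, hΨX, MvPolynomial.map_X, xi_eq_algebraMap_C, ← map_mul]
  rw [h]
  intro h0
  rw [map_eq_zero_iff _ (IsFractionRing.injective 𝒢.RUL 𝒢.LL)] at h0
  have hc := congrArg (coeff (Finsupp.single (i, 𝒢.j) 1)) h0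
  rw [coeff_sum, coeff_zero] at hc
  have hterm : ∀ k : Fin (m + 1), coeff (Finsupp.single (i, 𝒢.j) 1)
      ((X (i, k) : 𝒢.RUL) * C (𝒢.xb k)) = if k = 𝒢.j then 𝒢.xb k else 0 := by
    intro k
    rw [mul_comm, C_mul_X_eq_monomial, coeff_monomial]
    by_cases hk : k = 𝒢.j
    · subst hk; simp
    · rw [if_neg hk, if_neg]
      intro heq
      have := Finsupp.single_left_injective one_ne_zero heq
      exact hk (Prod.mk.inj this).2
  simp_rw [hterm] at hc
  rw [Finset.sum_ite_eq' Finset.univ 𝒢.j (fun k => 𝒢.xb k), if_pos (Finset.mem_univ _)] at hc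
  exact 𝒢.xb_j_ne_zero hc

/-! ## The kernel of the naive evaluation on forms -/

/-- A monomial of the degree of a form in its support is homogeneous of that degree. [folklore] -/
theorem isHomogeneous_monomial_of_mem_support {R : Type*} [CommSemiring R] {σ : Type*}
    {f : MvPolynomial σ R} {d : ℕ} (hf : f.IsHomogeneous d) {β : σ →₀ ℕ} (hβ : β ∈ f.support)
    {S : Type*} [CommSemiring S] (r : S) : (monomial β r).IsHomogeneous d := by
  refine isHomogeneous_monomial r ?_
  have h := hf (mem_support_iff.mp hβ)
  rw [Finsupp.degree_eq_weight_one]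
  exact h

/-- **The kernel of the naive evaluation on forms of degree `d` is spanned by `ι(𝔭_d)`**: a
`K'`-form `f` of degree `d` with `Ψ f = 0` is a `K'`-linear combination of images of rational forms
of degree `d` lying in `𝔭` (clear the denominators of the coefficients of `f` by `b ∈ ℚ[U'] ∖ 0`;
the numerator, regrouped as a polynomial in `U'` with coefficients `g_α ∈ ℚ[x]_d`, maps under the
naive evaluation to `∑_α ḡ_α U'^α ∈ ℚ(𝔭)[U'] ⊂ 𝕃`, which vanishes iff every `ḡ_α = 0`, i.e.
`g_α ∈ 𝔭`). [folklore] -/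
theorem mem_span_of_natEval_eq_zero (Ψ : MvPolynomial (Fin (m + 1)) 𝒢.Kp →+* 𝒢.LL)
    (hΨC : ∀ a : RU 𝒢.s m, Ψ (C (algebraMap (RU 𝒢.s m) 𝒢.Kp a)) =
      algebraMap 𝒢.RUL 𝒢.LL (MvPolynomial.map (algebraMap ℚ 𝒢.Lp) a))
    (hΨX : ∀ k, Ψ (X k) = 𝒢.xi k) {d : ℕ} {f : MvPolynomial (Fin (m + 1)) 𝒢.Kp}
    (hf : f ∈ homogeneousSubmodule (Fin (m + 1)) 𝒢.Kp d) (h0 : Ψ f = 0) :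
    f ∈ Submodule.span 𝒢.Kp
      (MvPolynomial.map (algebraMap ℚ 𝒢.Kp) '' (idealDegree 𝒢.𝔭 d : Set (Rx m))) := by
  classical
  rw [mem_homogeneousSubmodule] at hf
  set A : Type := RU 𝒢.s m
  set ι : Rx m →+* MvPolynomial (Fin (m + 1)) 𝒢.Kp := MvPolynomial.map (algebraMap ℚ 𝒢.Kp) with hι
  set π : Rx m →+* 𝒢.Lp := algebraMap (Rx m) 𝒢.Lp with hπ
  -- clear denominators
  obtain ⟨b, hb⟩ := IsLocalization.exist_integer_multiples (nonZeroDivisors A) f.support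
    fun β => coeff β f
  have hb' : ∀ β ∈ f.support, ∃ y : A, algebraMap A 𝒢.Kp y = (b : A) • coeff β f :=
    fun β hβ => hb β hβ
  choose! a ha using hb'
  have hb0 : algebraMap A 𝒢.Kp b ≠ 0 := IsFractionRing.to_map_ne_zero_of_mem_nonZeroDivisors b.2
  -- the numerator, regrouped in `U'`
  set G : MvPolynomial (Fin 𝒢.s × Fin (m + 1)) (Rx m) :=
    ∑ β ∈ f.support, MvPolynomial.map (C : ℚ →+* Rx m) (a β) * C (monomial β (1 : ℚ)) with hG
  -- (A) its `U'`-coefficients are forms of degree `d` …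
  have hGcoeff : ∀ α, coeff α G = ∑ β ∈ f.support, monomial β (coeff α (a β)) := by
    intro α
    rw [hG, coeff_sum]
    refine Finset.sum_congr rfl fun β _ => ?_
    rw [mul_comm, coeff_C_mul, coeff_map, mul_comm, C_mul_monomial, mul_one]
  have hGhom : ∀ α, (coeff α G).IsHomogeneous d := by
    intro α
    rw [hGcoeff]
    exact IsHomogeneous.sum _ _ _ fun β hβ => isHomogeneous_monomial_of_mem_support hf hβ _
  -- … lying in `𝔭`: evaluate naively
  have hΨf : Ψ f = ∑ β ∈ f.support, Ψ (C (coeff β f)) * ∏ k, 𝒢.xi k ^ β k := by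
    conv_lhs => rw [f.as_sum]
    rw [map_sum]
    refine Finset.sum_congr rfl fun β _ => ?_
    rw [monomial_eq, map_mul, map_finsuppProd]
    congr 1
    rw [Finsupp.prod_fintype _ _ (fun k => by rw [pow_zero, map_one])]
    exact Finset.prod_congr rfl fun k _ => by rw [map_pow, hΨX]
  have hmono : ∀ β : Fin (m + 1) →₀ ℕ, algebraMap 𝒢.RUL 𝒢.LL
      (MvPolynomial.map π (C (monomial β (1 : ℚ)))) = ∏ k, 𝒢.xi k ^ β k := by
    intro β
    rw [map_C, ← GSec.algebraMap_Lp_eq, monomial_eq, map_mul, map_mul, C_1, map_one, map_one,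
      one_mul, map_finsuppProd, map_finsuppProd,
      Finsupp.prod_fintype _ _ (fun k => by rw [pow_zero, map_one, map_one])]
    refine Finset.prod_congr rfl fun k _ => ?_
    rw [map_pow, map_pow]
    rfl
  have hmapC : ∀ y : A, algebraMap 𝒢.RUL 𝒢.LL (MvPolynomial.map π (MvPolynomial.map C y)) =
      Ψ (C (algebraMap A 𝒢.Kp y)) := by
    intro y
    rw [hΨC, map_map, ringHom_rat_eq (π.comp C) (algebraMap ℚ 𝒢.Lp)]
  have hG0 : algebraMap 𝒢.RUL 𝒢.LL (MvPolynomial.map π G) = 0 := by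
    have : algebraMap 𝒢.RUL 𝒢.LL (MvPolynomial.map π G) = Ψ (C (algebraMap A 𝒢.Kp b)) * Ψ f := by
      rw [hG, map_sum, map_sum, hΨf, Finset.mul_sum]
      refine Finset.sum_congr rfl fun β hβ => ?_
      rw [map_mul, map_mul, hmapC, hmono, ha β hβ, Algebra.smul_def, map_mul, map_mul, mul_assoc]
    rw [this, h0, mul_zero]
  have hGmem : ∀ α, coeff α G ∈ 𝒢.𝔭 := by
    intro α
    have h1 : MvPolynomial.map π G = 0 :=
      (map_eq_zero_iff _ (IsFractionRing.injective 𝒢.RUL 𝒢.LL)).mp hG0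
    have h2 := congrArg (coeff α) h1
    rw [coeff_map, coeff_zero] at h2
    exact (NesterenkoK.algebraMap_eq_zero_iff 𝒢.𝔭 _).mp h2
  -- (B) `f = b⁻¹ · G(ι, u)`
  set c : Fin 𝒢.s × Fin (m + 1) → MvPolynomial (Fin (m + 1)) 𝒢.Kp :=
    fun v => C (algebraMap A 𝒢.Kp (X v)) with hc
  have hevalC : ∀ y : A, eval₂ ι c (MvPolynomial.map C y) = C (algebraMap A 𝒢.Kp y) := by
    intro y
    rw [eval₂_map]
    have hhom : (eval₂Hom (ι.comp C) c : A →+* MvPolynomial (Fin (m + 1)) 𝒢.Kp) =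
        (C : 𝒢.Kp →+* MvPolynomial (Fin (m + 1)) 𝒢.Kp).comp (algebraMap A 𝒢.Kp) := by
      refine MvPolynomial.ringHom_ext (fun q => ?_) (fun v => ?_)
      · rw [eval₂Hom_C, RingHom.comp_apply, RingHom.comp_apply, hι, map_C]
        have e : (algebraMap A 𝒢.Kp).comp (C : ℚ →+* A) = algebraMap ℚ 𝒢.Kp := ringHom_rat_eq _ _
        rw [← e, RingHom.comp_apply]
      · rw [eval₂Hom_X', RingHom.comp_apply]
    exact congrArg (fun φ : A →+* MvPolynomial (Fin (m + 1)) 𝒢.Kp => φ y) hhom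
  have hevalG : eval₂ ι c G = C (algebraMap A 𝒢.Kp b) * f := by
    rw [hG, eval₂_sum]
    conv_rhs => rw [f.as_sum, Finset.mul_sum]
    refine Finset.sum_congr rfl fun β hβ => ?_
    rw [eval₂_mul, hevalC, eval₂_C, hι, map_monomial, map_one, ha β hβ, Algebra.smul_def, map_mul,
      mul_assoc, C_mul_monomial, mul_one]
  -- (C) `G(ι, u) ∈ span_{K'} ι(𝔭_d)`
  have hspan : eval₂ ι c G ∈ Submodule.span 𝒢.Kp (ι '' (idealDegree 𝒢.𝔭 d : Set (Rx m))) := by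
    rw [eval₂_eq]
    refine Submodule.sum_mem _ fun α _ => ?_
    have hprod : (∏ v ∈ α.support, c v ^ α v) = C (algebraMap A 𝒢.Kp (∏ v ∈ α.support, X v ^ α v)) := by
      rw [map_prod, map_prod]
      refine Finset.prod_congr rfl fun v _ => ?_
      rw [map_pow, map_pow]
    rw [hprod, mul_comm, ← smul_eq_C_mul]
    refine Submodule.smul_mem _ _ (Submodule.subset_span ⟨coeff α G, ?_, rfl⟩)
    exact ⟨hGmem α, hGhom α⟩
  have hf_eq : f = (algebraMap A 𝒢.Kp b)⁻¹ • eval₂ ι c G := by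
    rw [hevalG, smul_eq_C_mul, ← mul_assoc, ← C_mul, inv_mul_cancel₀ hb0, C_1, one_mul]
  rw [hf_eq]
  exact Submodule.smul_mem _ _ hspan

/-- **The generic linear form is a non-zero-divisor modulo `𝔭 K'[x]`, degreewise**: for a
`K'`-form `f` of degree `d`, `L_u · f ∈ span_{K'} ι(𝔭_{d+1}) ⇒ f ∈ span_{K'} ι(𝔭_d)`, where
`L_u = ∑ₖ u_{ik} x_k`. [folklore] -/
theorem mem_span_of_linForm_mul_mem_span (Ψ : MvPolynomial (Fin (m + 1)) 𝒢.Kp →+* 𝒢.LL)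
    (hΨC : ∀ a : RU 𝒢.s m, Ψ (C (algebraMap (RU 𝒢.s m) 𝒢.Kp a)) =
      algebraMap 𝒢.RUL 𝒢.LL (MvPolynomial.map (algebraMap ℚ 𝒢.Lp) a))
    (hΨX : ∀ k, Ψ (X k) = 𝒢.xi k) (i : Fin 𝒢.s) {d : ℕ} {f : MvPolynomial (Fin (m + 1)) 𝒢.Kp}
    (hf : f ∈ homogeneousSubmodule (Fin (m + 1)) 𝒢.Kp d)
    (hLf : (∑ k : Fin (m + 1), C (algebraMap (RU 𝒢.s m) 𝒢.Kp (X (i, k))) * X k) * f ∈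
      Submodule.span 𝒢.Kp
        (MvPolynomial.map (algebraMap ℚ 𝒢.Kp) '' (idealDegree 𝒢.𝔭 (d + 1) : Set (Rx m)))) :
    f ∈ Submodule.span 𝒢.Kp
      (MvPolynomial.map (algebraMap ℚ 𝒢.Kp) '' (idealDegree 𝒢.𝔭 d : Set (Rx m))) := by
  refine mem_span_of_natEval_eq_zero 𝒢 Ψ hΨC hΨX hf ?_
  -- `Ψ` kills the span of `ι(𝔭)`
  have hker : ∀ g ∈ Submodule.span 𝒢.Kp
      (MvPolynomial.map (algebraMap ℚ 𝒢.Kp) '' (idealDegree 𝒢.𝔭 (d + 1) : Set (Rx m))), Ψ g = 0 := by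
    intro g hg
    refine Submodule.span_induction ?_ ?_ ?_ ?_ hg
    · rintro _ ⟨p, hp, rfl⟩
      exact (natEval_map_eq_zero_iff 𝒢 Ψ hΨX p).mpr hp.1
    · exact map_zero Ψ
    · intro x y _ _ hx hy
      rw [map_add, hx, hy, add_zero]
    · intro r x _ hx
      rw [smul_eq_C_mul, map_mul, hx, mul_zero]
  have h := hker _ hLf
  rw [map_mul] at h
  exact (mul_eq_zero.mp h).resolve_left (natEval_linForm_ne_zero 𝒢 Ψ hΨC hΨX i)

end CurveHilbertLB

open Literature.NumberTheory.Transcendental Literature.NumberTheory.Transcendental.Nesterenko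
open MvPolynomial in
/-- **Summary (registered helper stub `cycleAPIAt3_linForm_nzd`)**: for `𝒢 : GSec m` and any of its
generic hyperplanes `L_u = ∑ₖ u_{ik} x_k`, multiplication by `L_u` is injective modulo `𝔭 K'[x]`
degreewise — a `K'`-form `f` of degree `d` with `L_u f ∈ span_{K'} ι(𝔭_{d+1})` lies in
`span_{K'} ι(𝔭_d)` (`K' = 𝒢.Kp`, `ι = MvPolynomial.map (algebraMap ℚ K')`). [folklore] -/
theorem cycleAPIAt3_linForm_nzd : ∀ {m : ℕ} (𝒢 : GSec m) (i : Fin 𝒢.s) (d : ℕ) (f : MvPolynomial (Fin (m + 1)) 𝒢.Kp), f ∈ homogeneousSubmodule (Fin (m + 1)) 𝒢.Kp d → (∑ k : Fin (m + 1), C (algebraMap (RU 𝒢.s m) 𝒢.Kp (X (i, k))) * X k) * f ∈ Submodule.span 𝒢.Kp (MvPolynomial.map (algebraMap ℚ 𝒢.Kp) '' (Literature.RingTheory.MvPolynomial.idealDegree 𝒢.𝔭 (d + 1) : Set (Rx m))) → f ∈ Submodule.span 𝒢.Kp (MvPolynomial.map (algebraMap ℚ 𝒢.Kp) '' (Literature.RingTheory.MvPolynomial.idealDegree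 𝒢.𝔭 d : Set (Rx m))) := by
  intro m 𝒢 i d f hf hLf
  obtain ⟨Ψ, hΨC, hΨX⟩ := CurveHilbertLB.exists_natEval 𝒢
  exact CurveHilbertLB.mem_span_of_linForm_mul_mem_span 𝒢 Ψ hΨC hΨX i hf hLf

end Summit.Schanuel.Schanuel.Cruxes.ApproximationProperty.OrbitInterpolationDeterminant

end
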